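import Literature.Analysis.FluidPDE.ForwardDSSMollifiedDrift
import Literature.Analysis.FluidPDE.ForwardDSSLocalEnergySobolev
import Literature.Analysis.FluidPDE.LerayHopfProofs
import HarnessLib

/-!
# Forward DSS solutions: the cubic (drift) term of Bradshaw–Tsai 2019, (3.9)–(3.11)

Analysis/FluidPDE proof file (theorems only) in the decomposition of
`Literature.Analysis.FluidPDE.bradshawTsai2019_prop_3_1` (Bradshaw–Tsai, Analysis & PDE 12
(2019) = arXiv:1801.08060, Prop. 3.1; the remaining analytic input is the a priori estimate
(3.12), cf. `bradshawTsai2019_prop_3_1_approximation` in `ForwardDSSLocalEnergyLimit`). The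
drift term of the local energy equality (3.7), `∫₀ᵗ∫ |v_ε|² ((η_{ε√s} * v_ε)·∇φ)`, is bounded in
print (p. 9) by

> (3.9) Young: `≤ C∫₀ᵗ∫_{B_λ}|v_ε|³ + C∫₀ᵗ∫_{B_λ}|(η_{ε√s} * v_ε)|³`; re-scaling:
> "`∫₀ᵗ∫_{B_λ}|v_ε|³ ≤ C(λ)∫₀^{t/λ²}∫_{B₁}|v_ε|³ ≤ C(λ)∫₀ᵗ∫|v_ε|³φ^{3/2}`"; (3.10) with `q = 3`;
> (3.11) "`∫₀ᵗ∫|v_ε|²((η_{ε√s} * v_ε)·∇φ) ≤ C(η,λ)∫₀ᵗ∫|v_ε|³φ^{3/2}`"; and, by Gagliardo–Nirenberg,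
> "`≤ C(λ,γ,η)∫₀ᵗ(α̃_ε(s)³ + α̃_ε(s)) ds + C(λ)γ∫₀ᵗ∫|∇v_ε|²φ`".

This file assembles these steps in the `ℝ≥0∞` bookkeeping of `ForwardDSSLocalEnergy` from the
accepted bricks — the scaling laws (3.6) (`ForwardDSSLocalEnergyScaling`), the drift bound (3.10)
(`ForwardDSSMollifiedDrift`) and the localized Gagliardo–Nirenberg bound
(`ForwardDSSLocalEnergySobolev`) — for a `λ`-DSS field `w` which is continuous on the open slab
with `C¹` slices and continuous slice-gradient `H`, a cut-off `χ` (`φ = χ²`, `|χ| ≤ 1`,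
`‖Dχ‖ ≤ M`, `χ = 1` on `B₁`, `χ = 0` off `B_λ`) and the drift `b = η_{ε√s} * w` (`ερ ≤ λ − 1`):

* `setLIntegral_cylinder_sq_mul_drift_le` (**(3.9)–(3.10)**):
  `∫∫_{(0,t)×B_λ} |w|²|b| ≤ (λ² + λ⁴) ∫∫_{(0,t)×B₁} |w|³` for `0 < t ≤ 1`;
* `setLIntegral_unitCylinder_cube_le` (**Gagliardo–Nirenberg, integrated**): for `0 < γ < ∞`,
  `∫∫_{(0,t)×B₁} |w|³ ≤ C ∫₀ᵗ (α̃³ + α̃) + γ ∫∫_{(0,t)×E} χ²|H|²`, `C = C(λ, χ, γ)`;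
* `setLIntegral_cylinder_sq_mul_drift_le_supBallEnergy` (**the display after (3.11)**): for
  every `γ ∈ (0,∞)` a constant `C(λ, χ, γ) < ∞` with
  `∫∫_{(0,t)×B_λ} |w|²|b| ≤ C ∫₀ᵗ (α̃³ + α̃) + γ ∫∫_{(0,t)×E} χ²|H|²`, `0 < t ≤ 1`.

(The factor `sup|∇φ| ≤ 2M` in front of the drift term and the conversion to the real-valued
energy equality are left to the consumer.) Tonelli is used in the inequality form
`lintegral_prod_le` where no measurability is available (the drift), and as an equality for the
continuous integrands `|w|³`, `χ²|H|²`.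

## References

* Z. Bradshaw, T.-P. Tsai, Analysis & PDE 12 (2019) 1943–1962 = arXiv:1801.08060, §3, proof of
  Prop. 3.1, (3.9)–(3.11) and the Gagliardo–Nirenberg display, p. 9 [BradshawTsai2019].
-/

noncomputable section

open MeasureTheory Set Function Filter Metric Module
open scoped NNReal ENNReal Topology

namespace Literature.Analysis.FluidPDE

namespace BradshawTsai2019

section Cubic

variable {E : Type*} [NormedAddCommGroup E] [InnerProductSpace ℝ E] [FiniteDimensional ℝ E]
  [MeasurableSpace E] [BorelSpace E]

/-! ## Measurability on the open slab and Tonelli -/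

/-- The restriction of Lebesgue measure on `ℝ × E` to a product set is the product of the
restrictions (general-`E` form of `BradshawTsai2017.volume_restrict_prod` of
`ForwardDSSLocalLerayEnergy`, which is stated on `ℝ × ℝ³` and not imported here). [folklore] -/
theorem volume_restrict_real_prod (I : Set ℝ) (S : Set E) :
    (volume : Measure (ℝ × E)).restrict (I ×ˢ S) =
      ((volume : Measure ℝ).restrict I).prod ((volume : Measure E).restrict S) := by
  rw [Measure.volume_eq_prod, Measure.prod_restrict]

/-- A field continuous on the open slab `(0,∞) × E` is a.e.-strongly measurable on every
`(0,t) × S` (`S` measurable). General-`E` form of the `ℝ³` lemma preceding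
`continuous_slice_of_continuousOn_slab` in `CaloricLocalLerayLp` (heat-kernel chain, not imported).
[folklore] -/
theorem aestronglyMeasurable_restrict_of_continuousOn {F : Type*} [TopologicalSpace F]
    [TopologicalSpace.PseudoMetrizableSpace F] {U : ℝ × E → F}
    (hU : ContinuousOn U (Ioi (0 : ℝ) ×ˢ (univ : Set E))) (t : ℝ) {S : Set E}
    (hS : MeasurableSet S) :
    AEStronglyMeasurable U (volume.restrict (Ioo (0 : ℝ) t ×ˢ S)) :=
  (hU.mono (prod_mono Ioo_subset_Ioi_self (subset_univ S))).aestronglyMeasurable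
    (measurableSet_Ioo.prod hS)

/-- **Tonelli on a cylinder** for a non-negative integrand a.e.-measurable on `(0,t) × S`:
`∫∫_{(0,t)×S} F = ∫₀ᵗ ∫_S F`. [folklore] -/
theorem setLIntegral_cylinder_eq_iterate {F : ℝ × E → ℝ≥0∞} {t : ℝ} {S : Set E}
    (hF : AEMeasurable F (volume.restrict (Ioo (0 : ℝ) t ×ˢ S))) :
    ∫⁻ z in Ioo (0 : ℝ) t ×ˢ S, F z = ∫⁻ s in Ioo (0 : ℝ) t, ∫⁻ x in S, F (s, x) := by
  rw [volume_restrict_real_prod] at hF ⊢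
  exact lintegral_prod _ hF

/-- **Tonelli, inequality form** (no measurability): `∫∫_{(0,t)×S} F ≤ ∫₀ᵗ ∫_S F`. [folklore] -/
theorem setLIntegral_cylinder_le_iterate (F : ℝ × E → ℝ≥0∞) (t : ℝ) (S : Set E) :
    ∫⁻ z in Ioo (0 : ℝ) t ×ˢ S, F z ≤ ∫⁻ s in Ioo (0 : ℝ) t, ∫⁻ x in S, F (s, x) := by
  rw [volume_restrict_real_prod]
  exact lintegral_prod_le _

/-! ## Pointwise and slice facts -/

omit [InnerProductSpace ℝ E] [FiniteDimensional ℝ E] [MeasurableSpace E] [BorelSpace E] in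
/-- **Young for the drift term**, crude form: `a²b ≤ a³ + b³` in `ℝ≥0∞` (if `b ≤ a` the left side
is at most `a³`, otherwise at most `b³`; (3.9): "using Young's inequality"). [folklore] -/
theorem sq_mul_le_rpow_three_add (a b : ℝ≥0∞) :
    a ^ 2 * b ≤ a ^ (3 : ℝ) + b ^ (3 : ℝ) := by
  have h3 : ∀ x : ℝ≥0∞, x ^ (3 : ℝ) = x ^ 3 := fun x => by
    rw [show (3 : ℝ) = ((3 : ℕ) : ℝ) by norm_num, ENNReal.rpow_natCast]
  rw [h3, h3]
  rcases le_total b a with h | h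
  · calc a ^ 2 * b ≤ a ^ 2 * a := mul_le_mul' le_rfl h
      _ = a ^ 3 := by ring
      _ ≤ a ^ 3 + b ^ 3 := le_self_add
  · calc a ^ 2 * b ≤ b ^ 2 * b := mul_le_mul' (pow_le_pow_left' h 2) le_rfl
      _ = b ^ 3 := by ring
      _ ≤ a ^ 3 + b ^ 3 := le_add_self

omit [InnerProductSpace ℝ E] [FiniteDimensional ℝ E] [MeasurableSpace E] [BorelSpace E] in
/-- Slices of a field continuous on the open slab are continuous (general-`E` form of
`continuous_slice_of_continuousOn_slab` of `CaloricLocalLerayLp`, not imported). [folklore] -/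
theorem continuous_slice_of_continuousOn {F : Type*} [TopologicalSpace F] {U : ℝ → E → F}
    (hU : ContinuousOn (uncurry U) (Ioi (0 : ℝ) ×ˢ (univ : Set E))) {s : ℝ} (hs : 0 < s) :
    Continuous (U s) := by
  have h : Continuous fun x : E => uncurry U (s, x) :=
    hU.comp_continuous (continuous_const.prodMk continuous_id) fun x => ⟨hs, mem_univ x⟩
  exact h

/-! ## (3.9)–(3.10): the drift term by cubic masses, then the re-scaling to `B₁` -/

/-- **Bradshaw–Tsai 2019, (3.9)–(3.10) with the re-scaling of the cubic terms** (p. 9). Let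
`λ > 1`, `η ≥ 0` continuous of unit mass vanishing off `B_ρ`, `0 < ε` with `ερ ≤ λ − 1`, and let
`w` be `λ`-DSS and continuous on the open slab, `b = η_{ε√s} * w` its drift. Then for
`0 < t ≤ 1`,
`∫∫_{(0,t)×B_λ} |w|²|b| ≤ ∫∫_{(0,t)×B_λ} |w|³ + ∫∫_{(0,t)×B_λ} |b|³ ≤ (λ² + λ⁴) ∫∫_{(0,t)×B₁} |w|³`
("Young's inequality … `≤ C∫₀ᵗ∫_{B_λ}|v_ε|³ + C∫₀ᵗ∫_{B_λ}|(η_{ε√s} * v_ε)|³`"; (3.10) with `q = 3`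
sends the drift to `∫₀ᵗ∫_{B_{λ²}}|v_ε|³`; "Re-scaling … `∫₀ᵗ∫_{B_λ}|v_ε|³ ≤ C(λ)∫₀^{t/λ²}∫_{B₁}|v_ε|³`"
with `C(λ) = λ²`, and `λ⁴` for `B_{λ²}`). [cite: BradshawTsai2019, §3 (3.9)–(3.11)] -/
theorem setLIntegral_cylinder_sq_mul_drift_le {c : ℝ} (hc : 1 < c) {η : E → ℝ}
    (hηc : Continuous η) (hη0 : ∀ y, 0 ≤ η y) (hη1 : ∫ y, η y = 1) {ρ : ℝ}
    (hηρ : ∀ y, ρ ≤ ‖y‖ → η y = 0) {ε : ℝ} (hε : 0 < ε) (hερ : ε * ρ ≤ c - 1)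
    (hE : finrank ℝ E = 3) {w : ℝ → E → E} (hw : IsDiscretelySelfSimilar c w)
    (hwm : ContinuousOn (uncurry w) (Ioi (0 : ℝ) ×ˢ (univ : Set E))) {t : ℝ} (ht0 : 0 < t)
    (ht1 : t ≤ 1) :
    ∫⁻ z in Ioo (0 : ℝ) t ×ˢ ball (0 : E) c,
        ‖w z.1 z.2‖ₑ ^ 2 * ‖mollifiedDrift η ε w z.1 z.2‖ₑ ≤
      (ENNReal.ofReal (c ^ 2) + ENNReal.ofReal (c ^ 4)) *
        ∫⁻ z in Ioo (0 : ℝ) t ×ˢ ball (0 : E) 1, ‖w z.1 z.2‖ₑ ^ (3 : ℝ) := by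
  have hc0 : 0 < c := zero_lt_one.trans hc
  have hc2 : 1 < c ^ 2 := one_lt_pow₀ hc two_ne_zero
  -- measurability of `|w|³` on cylinders
  have hW3 : ∀ S : Set E, MeasurableSet S → AEMeasurable (fun z : ℝ × E => ‖w z.1 z.2‖ₑ ^ (3 : ℝ))
      (volume.restrict (Ioo (0 : ℝ) t ×ˢ S)) := fun S hS =>
    ((aestronglyMeasurable_restrict_of_continuousOn hwm t hS).enorm.pow_const _)
  -- Young
  have hY : ∫⁻ z in Ioo (0 : ℝ) t ×ˢ ball (0 : E) c, ‖w z.1 z.2‖ₑ ^ 2 * ‖mollifiedDrift η ε w z.1 z.2‖ₑ ≤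
      (∫⁻ z in Ioo (0 : ℝ) t ×ˢ ball (0 : E) c, ‖w z.1 z.2‖ₑ ^ (3 : ℝ)) +
        ∫⁻ z in Ioo (0 : ℝ) t ×ˢ ball (0 : E) c, ‖mollifiedDrift η ε w z.1 z.2‖ₑ ^ (3 : ℝ) := by
    rw [← lintegral_add_left' (hW3 _ measurableSet_ball)]
    exact lintegral_mono fun z => sq_mul_le_rpow_three_add _ _
  -- (3.10) slice-wise, integrated: `∫∫_{(0,t)×B_λ} |b|³ ≤ ∫∫_{(0,t)×B_{λ²}} |w|³`
  have hB : ∫⁻ z in Ioo (0 : ℝ) t ×ˢ ball (0 : E) c, ‖mollifiedDrift η ε w z.1 z.2‖ₑ ^ (3 : ℝ) ≤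
      ∫⁻ z in Ioo (0 : ℝ) t ×ˢ ball (0 : E) (c ^ 2), ‖w z.1 z.2‖ₑ ^ (3 : ℝ) := by
    calc ∫⁻ z in Ioo (0 : ℝ) t ×ˢ ball (0 : E) c, ‖mollifiedDrift η ε w z.1 z.2‖ₑ ^ (3 : ℝ)
        ≤ ∫⁻ s in Ioo (0 : ℝ) t, ∫⁻ x in ball (0 : E) c, ‖mollifiedDrift η ε w s x‖ₑ ^ (3 : ℝ) :=
          setLIntegral_cylinder_le_iterate _ t _
      _ ≤ ∫⁻ s in Ioo (0 : ℝ) t, ∫⁻ x in ball (0 : E) (c ^ 2), ‖w s x‖ₑ ^ (3 : ℝ) := by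
          refine setLIntegral_mono' measurableSet_Ioo fun s hs => ?_
          have h := setLIntegral_ball_pow_enorm_mollifiedDrift_rpow_le (F := E) hc hηc hη0 hη1 hηρ
            hε hερ hs.1 (hs.2.le.trans ht1)
            (continuous_slice_of_continuousOn hwm hs.1).aestronglyMeasurable
            (q := 3) (by norm_num) 1
          rwa [pow_one, show (1 + 1 : ℕ) = 2 from rfl] at h
      _ = ∫⁻ z in Ioo (0 : ℝ) t ×ˢ ball (0 : E) (c ^ 2), ‖w z.1 z.2‖ₑ ^ (3 : ℝ) :=
          (setLIntegral_cylinder_eq_iterate (hW3 _ measurableSet_ball)).symm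
  -- re-scaling of both cubic masses to the unit ball
  have key1 := setLIntegral_cylinder_enorm_rpow_eq_of_dss (E := E) (F := E) hc0 hw
    (by norm_num : (0 : ℝ) ≤ 3) 1 t
  have key2 := setLIntegral_cylinder_enorm_rpow_eq_of_dss (E := E) (F := E) (pow_pos hc0 2)
    (isDiscretelySelfSimilar_pow hw 2) (by norm_num : (0 : ℝ) ≤ 3) 1 t
  rw [hE] at key1 key2
  -- the scaling constants: `‖γ‖ₑ³ (γ·γ·γ³)⁻¹ = (γ²)⁻¹`
  have hconst : ∀ {γ : ℝ}, 0 < γ →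
      ‖γ‖ₑ ^ (3 : ℝ) * ENNReal.ofReal (γ * γ * γ ^ 3)⁻¹ = (ENNReal.ofReal (γ ^ 2))⁻¹ := by
    intro γ hγ
    rw [Real.enorm_eq_ofReal hγ.le, ENNReal.ofReal_rpow_of_nonneg hγ.le (by norm_num),
      show ((3 : ℝ)) = ((3 : ℕ) : ℝ) by norm_num, Real.rpow_natCast,
      ← ENNReal.ofReal_mul (by positivity), ← ENNReal.ofReal_inv_of_pos (by positivity)]
    congr 1
    field_simp
  rw [hconst hc0] at key1
  rw [hconst (pow_pos hc0 2)] at key2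
  -- from `∫∫_{small} = K⁻¹ ∫∫_{big}` to `∫∫_{big} ≤ K ∫∫_{(0,t)×B₁}` (enlarging the time interval)
  have hbig : ∀ {γ : ℝ}, 1 < γ →
      (∫⁻ z in Ioo 0 ((γ ^ 2)⁻¹ * t) ×ˢ ball (0 : E) 1, ‖w z.1 z.2‖ₑ ^ (3 : ℝ)) =
        (ENNReal.ofReal (γ ^ 2))⁻¹ * ∫⁻ z in Ioo 0 t ×ˢ ball (0 : E) (γ * 1), ‖w z.1 z.2‖ₑ ^ (3 : ℝ) →
      ∫⁻ z in Ioo 0 t ×ˢ ball (0 : E) γ, ‖w z.1 z.2‖ₑ ^ (3 : ℝ) ≤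
        ENNReal.ofReal (γ ^ 2) * ∫⁻ z in Ioo (0 : ℝ) t ×ˢ ball (0 : E) 1, ‖w z.1 z.2‖ₑ ^ (3 : ℝ) := by
    intro γ hγ key
    have hγ0 : 0 < γ := zero_lt_one.trans hγ
    have h2 : ENNReal.ofReal (γ ^ 2) ≠ 0 := (ENNReal.ofReal_pos.2 (by positivity)).ne'
    rw [mul_one] at key
    have e : ∫⁻ z in Ioo 0 t ×ˢ ball (0 : E) γ, ‖w z.1 z.2‖ₑ ^ (3 : ℝ) =
        ENNReal.ofReal (γ ^ 2) *
          ∫⁻ z in Ioo 0 ((γ ^ 2)⁻¹ * t) ×ˢ ball (0 : E) 1, ‖w z.1 z.2‖ₑ ^ (3 : ℝ) := by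
      rw [key, ← mul_assoc, ENNReal.mul_inv_cancel h2 ENNReal.ofReal_ne_top, one_mul]
    rw [e]
    refine mul_le_mul' le_rfl (lintegral_mono_set (prod_mono (Ioo_subset_Ioo le_rfl ?_) Subset.rfl))
    have h1 : (γ ^ 2)⁻¹ ≤ 1 := inv_le_one_of_one_le₀ (one_le_pow₀ hγ.le)
    calc (γ ^ 2)⁻¹ * t ≤ 1 * t := mul_le_mul_of_nonneg_right h1 ht0.le
      _ = t := one_mul t
  have hA := hbig hc key1
  have hB' : ∫⁻ z in Ioo (0 : ℝ) t ×ˢ ball (0 : E) (c ^ 2), ‖w z.1 z.2‖ₑ ^ (3 : ℝ) ≤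
      ENNReal.ofReal (c ^ 4) * ∫⁻ z in Ioo (0 : ℝ) t ×ˢ ball (0 : E) 1, ‖w z.1 z.2‖ₑ ^ (3 : ℝ) := by
    have h := hbig hc2 key2
    rwa [show (c ^ 2) ^ 2 = c ^ 4 by ring] at h
  calc ∫⁻ z in Ioo (0 : ℝ) t ×ˢ ball (0 : E) c, ‖w z.1 z.2‖ₑ ^ 2 * ‖mollifiedDrift η ε w z.1 z.2‖ₑ
      ≤ (∫⁻ z in Ioo (0 : ℝ) t ×ˢ ball (0 : E) c, ‖w z.1 z.2‖ₑ ^ (3 : ℝ)) +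
          ∫⁻ z in Ioo (0 : ℝ) t ×ˢ ball (0 : E) c, ‖mollifiedDrift η ε w z.1 z.2‖ₑ ^ (3 : ℝ) := hY
    _ ≤ ENNReal.ofReal (c ^ 2) * (∫⁻ z in Ioo (0 : ℝ) t ×ˢ ball (0 : E) 1, ‖w z.1 z.2‖ₑ ^ (3 : ℝ)) +
          ENNReal.ofReal (c ^ 4) * ∫⁻ z in Ioo (0 : ℝ) t ×ˢ ball (0 : E) 1, ‖w z.1 z.2‖ₑ ^ (3 : ℝ) :=
        add_le_add hA (hB.trans hB')
    _ = (ENNReal.ofReal (c ^ 2) + ENNReal.ofReal (c ^ 4)) *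
          ∫⁻ z in Ioo (0 : ℝ) t ×ˢ ball (0 : E) 1, ‖w z.1 z.2‖ₑ ^ (3 : ℝ) := (add_mul _ _ _).symm

end Cubic

/-! ## Gagliardo–Nirenberg integrated in time, and the display after (3.11) (`E = ℝ³`) -/

section R3

variable {c : ℝ} {w : ℝ → EuclideanSpace ℝ (Fin 3) → EuclideanSpace ℝ (Fin 3)}
  {H : ℝ → EuclideanSpace ℝ (Fin 3) → EuclideanSpace ℝ (Fin 3) →L[ℝ] EuclideanSpace ℝ (Fin 3)}
  {χ : EuclideanSpace ℝ (Fin 3) → ℝ}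

/-- `α̃` is measurable (it is monotone). [folklore] -/
theorem measurable_supBallEnergy (u : ℝ → EuclideanSpace ℝ (Fin 3) → EuclideanSpace ℝ (Fin 3)) :
    Measurable (supBallEnergy u) :=
  Monotone.measurable fun _ _ h => supBallEnergy_mono u h

/-- **Gagliardo–Nirenberg, integrated in time** (the last display before "Thus," on p. 9 of
Bradshaw–Tsai 2019, integrated over `(0,t)`): let `λ > 1`, `w` a `λ`-DSS field with `C¹` slices
on `t > 0` whose gradients `H(s) = D(w(s))` are continuous on the open slab, and `χ` a
`C¹` cut-off with `|χ| ≤ 1`, `‖Dχ‖ ≤ M`, `χ = 1` on `B₁`, `χ = 0` off `B_λ`. For every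
`γ ∈ (0,∞)` there is `C < ∞` with, for all `t > 0`,
`∫∫_{(0,t)×B₁} |w|³ ≤ C ∫₀ᵗ (α̃(s)³ + α̃(s)) ds + γ ∫∫_{(0,t)×ℝ³} χ²|H|²`
(slice-wise: `∫_{B₁}|w(s)|³ ≤ ∫|χw(s)|³ ≤ C₀(A³ + A) + γ∫χ²|Dw(s)|²` by the localized
Gagliardo–Nirenberg bound, with `A = ‖w(s)‖²_{L²(B_λ)} ≤ λα̃(s)` by (3.6); then Tonelli).
[cite: BradshawTsai2019, §3 p. 9 (Gagliardo–Nirenberg step)] -/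
theorem setLIntegral_unitCylinder_cube_le (hc : 1 < c) (hw : IsDiscretelySelfSimilar c w)
    (hws : ∀ s, 0 < s → ContDiff ℝ 1 (w s))
    (hH : ∀ s, 0 < s → ∀ x, H s x = fderiv ℝ (w s) x)
    (hHm : ContinuousOn (uncurry H) (Ioi (0 : ℝ) ×ˢ (univ : Set (EuclideanSpace ℝ (Fin 3)))))
    (hχ : ContDiff ℝ 1 χ) (hχ1 : ∀ x, |χ x| ≤ 1) {M : ℝ} (hM : ∀ x, ‖fderiv ℝ χ x‖ ≤ M)
    (hχc : ∀ x, c ≤ ‖x‖ → χ x = 0) (hχB : ∀ x ∈ ball (0 : EuclideanSpace ℝ (Fin 3)) 1, χ x = 1)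
    {γ : ℝ≥0∞} (hγ0 : γ ≠ 0) (hγt : γ ≠ ⊤) :
    ∃ C : ℝ≥0∞, C ≠ ⊤ ∧ ∀ t : ℝ, 0 < t →
      ∫⁻ z in Ioo (0 : ℝ) t ×ˢ ball (0 : EuclideanSpace ℝ (Fin 3)) 1, ‖w z.1 z.2‖ₑ ^ (3 : ℝ) ≤
        C * (∫⁻ s in Ioo (0 : ℝ) t, (supBallEnergy w s ^ 3 + supBallEnergy w s)) +
          γ * ∫⁻ z in Ioo (0 : ℝ) t ×ˢ (univ : Set (EuclideanSpace ℝ (Fin 3))),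
            ENNReal.ofReal (χ z.2 ^ 2 * frobeniusNormSq (H z.1 z.2)) := by
  have hc0 : 0 < c := zero_lt_one.trans hc
  obtain ⟨C₀, hC₀t, hGN⟩ := lintegral_enorm_cutoff_smul_rpow_three_le
    (E := EuclideanSpace ℝ (Fin 3)) (F' := EuclideanSpace ℝ (Fin 3)) finrank_euclideanSpace_fin
    hχ hχ1 hM (R := c) hχc hγ0 hγt
  set K : ℝ≥0∞ := ENNReal.ofReal c ^ 3 with hK
  have hK1 : 1 ≤ ENNReal.ofReal c := by
    rw [← ENNReal.ofReal_one]; exact ENNReal.ofReal_le_ofReal hc.le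
  refine ⟨C₀ * K, ENNReal.mul_ne_top hC₀t (ENNReal.pow_ne_top ENNReal.ofReal_ne_top), fun t ht => ?_⟩
  -- the slice bound
  have hslice : ∀ s ∈ Ioo (0 : ℝ) t,
      ∫⁻ x in ball (0 : EuclideanSpace ℝ (Fin 3)) 1, ‖w s x‖ₑ ^ (3 : ℝ) ≤
        C₀ * K * (supBallEnergy w s ^ 3 + supBallEnergy w s) +
          γ * ∫⁻ x, ENNReal.ofReal (χ x ^ 2 * frobeniusNormSq (H s x)) := by
    intro s hs
    have h1 : ∫⁻ x in ball (0 : EuclideanSpace ℝ (Fin 3)) 1, ‖w s x‖ₑ ^ (3 : ℝ) ≤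
        ∫⁻ x, ‖χ x • w s x‖ₑ ^ (3 : ℝ) := by
      calc ∫⁻ x in ball (0 : EuclideanSpace ℝ (Fin 3)) 1, ‖w s x‖ₑ ^ (3 : ℝ)
          = ∫⁻ x in ball (0 : EuclideanSpace ℝ (Fin 3)) 1, ‖χ x • w s x‖ₑ ^ (3 : ℝ) :=
            setLIntegral_congr_fun measurableSet_ball fun x hx => by rw [hχB x hx, one_smul]
        _ ≤ ∫⁻ x, ‖χ x • w s x‖ₑ ^ (3 : ℝ) := setLIntegral_le_lintegral _ _
    have h2 := hGN (w s) (hws s hs.1)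
    -- the `L²(B_λ)` mass by `α̃`
    set A : ℝ≥0∞ := ∫⁻ x in ball (0 : EuclideanSpace ℝ (Fin 3)) c, ‖w s x‖ₑ ^ 2 with hA
    have hAle : A ≤ ENNReal.ofReal c * supBallEnergy w s :=
      setLIntegral_ball_enorm_sq_le_supBallEnergy hc hw hs.1
    have hA3 : A ^ 3 + A ≤ K * (supBallEnergy w s ^ 3 + supBallEnergy w s) := by
      rw [mul_add]
      refine add_le_add ?_ ?_
      · calc A ^ 3 ≤ (ENNReal.ofReal c * supBallEnergy w s) ^ 3 := pow_le_pow_left' hAle 3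
          _ = K * supBallEnergy w s ^ 3 := by rw [hK, mul_pow]
      · calc A ≤ ENNReal.ofReal c * supBallEnergy w s := hAle
          _ ≤ K * supBallEnergy w s := by
              refine mul_le_mul' ?_ le_rfl
              calc ENNReal.ofReal c = ENNReal.ofReal c ^ 1 := (pow_one _).symm
                _ ≤ ENNReal.ofReal c ^ 3 := pow_le_pow_right' hK1 (by norm_num)
    -- the gradient term with `H(s) = D(w(s))`
    have hG : ∫⁻ x, ENNReal.ofReal (χ x ^ 2 * frobeniusNormSq (fderiv ℝ (w s) x)) =
        ∫⁻ x, ENNReal.ofReal (χ x ^ 2 * frobeniusNormSq (H s x)) :=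
      lintegral_congr fun x => by rw [hH s hs.1 x]
    calc ∫⁻ x in ball (0 : EuclideanSpace ℝ (Fin 3)) 1, ‖w s x‖ₑ ^ (3 : ℝ)
        ≤ ∫⁻ x, ‖χ x • w s x‖ₑ ^ (3 : ℝ) := h1
      _ ≤ C₀ * (A ^ 3 + A) +
            γ * ∫⁻ x, ENNReal.ofReal (χ x ^ 2 * frobeniusNormSq (fderiv ℝ (w s) x)) := h2
      _ ≤ C₀ * (K * (supBallEnergy w s ^ 3 + supBallEnergy w s)) +
            γ * ∫⁻ x, ENNReal.ofReal (χ x ^ 2 * frobeniusNormSq (H s x)) := by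
          rw [hG]; exact add_le_add (mul_le_mul' le_rfl hA3) le_rfl
      _ = C₀ * K * (supBallEnergy w s ^ 3 + supBallEnergy w s) +
            γ * ∫⁻ x, ENNReal.ofReal (χ x ^ 2 * frobeniusNormSq (H s x)) := by rw [mul_assoc]
  -- measurability of the two right-hand integrands
  have hmeas0 : Measurable fun s => supBallEnergy w s ^ 3 + supBallEnergy w s :=
    ((measurable_supBallEnergy w).pow_const 3).add (measurable_supBallEnergy w)
  have hmeas1 : Measurable fun s => C₀ * K * (supBallEnergy w s ^ 3 + supBallEnergy w s) :=
    hmeas0.const_mul _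
  have hmeas2 : AEMeasurable (fun z : ℝ × EuclideanSpace ℝ (Fin 3) =>
      ENNReal.ofReal (χ z.2 ^ 2 * frobeniusNormSq (H z.1 z.2)))
      (volume.restrict (Ioo (0 : ℝ) t ×ˢ (univ : Set (EuclideanSpace ℝ (Fin 3))))) := by
    have hc2 : ContinuousOn (fun z : ℝ × EuclideanSpace ℝ (Fin 3) =>
        χ z.2 ^ 2 * frobeniusNormSq (H z.1 z.2))
        (Ioi (0 : ℝ) ×ˢ (univ : Set (EuclideanSpace ℝ (Fin 3)))) :=
      ((hχ.continuous.comp continuous_snd).pow 2).continuousOn.mul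
        (LerayHopfProofs.continuous_frobeniusNormSq.comp_continuousOn hHm)
    exact (aestronglyMeasurable_restrict_of_continuousOn hc2 t MeasurableSet.univ).aemeasurable.ennreal_ofReal
  -- integrate the slice bound over `(0, t)`
  calc ∫⁻ z in Ioo (0 : ℝ) t ×ˢ ball (0 : EuclideanSpace ℝ (Fin 3)) 1, ‖w z.1 z.2‖ₑ ^ (3 : ℝ)
      ≤ ∫⁻ s in Ioo (0 : ℝ) t, ∫⁻ x in ball (0 : EuclideanSpace ℝ (Fin 3)) 1, ‖w s x‖ₑ ^ (3 : ℝ) :=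
        setLIntegral_cylinder_le_iterate _ t _
    _ ≤ ∫⁻ s in Ioo (0 : ℝ) t, (C₀ * K * (supBallEnergy w s ^ 3 + supBallEnergy w s) +
          γ * ∫⁻ x, ENNReal.ofReal (χ x ^ 2 * frobeniusNormSq (H s x))) :=
        setLIntegral_mono' measurableSet_Ioo hslice
    _ = C₀ * K * (∫⁻ s in Ioo (0 : ℝ) t, (supBallEnergy w s ^ 3 + supBallEnergy w s)) +
          γ * ∫⁻ s in Ioo (0 : ℝ) t, ∫⁻ x, ENNReal.ofReal (χ x ^ 2 * frobeniusNormSq (H s x)) := by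
        rw [lintegral_add_left hmeas1, lintegral_const_mul _ hmeas0, lintegral_const_mul' _ _ hγt]
    _ = C₀ * K * (∫⁻ s in Ioo (0 : ℝ) t, (supBallEnergy w s ^ 3 + supBallEnergy w s)) +
          γ * ∫⁻ z in Ioo (0 : ℝ) t ×ˢ (univ : Set (EuclideanSpace ℝ (Fin 3))),
            ENNReal.ofReal (χ z.2 ^ 2 * frobeniusNormSq (H z.1 z.2)) := by
        rw [setLIntegral_cylinder_eq_iterate hmeas2]
        simp only [Measure.restrict_univ]

/-- **Bradshaw–Tsai 2019, the display after (3.11)** (p. 9: "Thus,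
`∫₀ᵗ∫|v_ε|²((η_{ε√s} * v_ε)·∇φ) ≤ C(λ,γ,η)∫₀ᵗ(α̃_ε(s)³ + α̃_ε(s)) ds + C(λ)γ∫₀ᵗ∫|∇v_ε|²φ`"), in the
form: for every `γ ∈ (0,∞)` there is `C < ∞` (depending on `λ`, the cut-off and `γ`) such that
for `0 < t ≤ 1`,
`∫∫_{(0,t)×B_λ} |w|² |η_{ε√s} * w| ≤ C ∫₀ᵗ (α̃³ + α̃) + γ ∫∫_{(0,t)×ℝ³} χ²|H|²`
(the weight `|∇φ| ≤ 2M`, supported in `B_λ`, is left to the consumer). Combination of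
`setLIntegral_cylinder_sq_mul_drift_le` and `setLIntegral_unitCylinder_cube_le` with
`γ/(λ² + λ⁴)`. [cite: BradshawTsai2019, §3 (3.11) and the following display] -/
theorem setLIntegral_cylinder_sq_mul_drift_le_supBallEnergy (hc : 1 < c)
    {η : EuclideanSpace ℝ (Fin 3) → ℝ} (hηc : Continuous η) (hη0 : ∀ y, 0 ≤ η y)
    (hη1 : ∫ y, η y = 1) {ρ : ℝ} (hηρ : ∀ y, ρ ≤ ‖y‖ → η y = 0) {ε : ℝ} (hε : 0 < ε)
    (hερ : ε * ρ ≤ c - 1) (hw : IsDiscretelySelfSimilar c w)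
    (hwm : ContinuousOn (uncurry w) (Ioi (0 : ℝ) ×ˢ (univ : Set (EuclideanSpace ℝ (Fin 3)))))
    (hws : ∀ s, 0 < s → ContDiff ℝ 1 (w s))
    (hH : ∀ s, 0 < s → ∀ x, H s x = fderiv ℝ (w s) x)
    (hHm : ContinuousOn (uncurry H) (Ioi (0 : ℝ) ×ˢ (univ : Set (EuclideanSpace ℝ (Fin 3)))))
    (hχ : ContDiff ℝ 1 χ) (hχ1 : ∀ x, |χ x| ≤ 1) {M : ℝ} (hM : ∀ x, ‖fderiv ℝ χ x‖ ≤ M)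
    (hχc : ∀ x, c ≤ ‖x‖ → χ x = 0) (hχB : ∀ x ∈ ball (0 : EuclideanSpace ℝ (Fin 3)) 1, χ x = 1)
    {γ : ℝ≥0∞} (hγ0 : γ ≠ 0) (hγt : γ ≠ ⊤) :
    ∃ C : ℝ≥0∞, C ≠ ⊤ ∧ ∀ t : ℝ, 0 < t → t ≤ 1 →
      ∫⁻ z in Ioo (0 : ℝ) t ×ˢ ball (0 : EuclideanSpace ℝ (Fin 3)) c,
          ‖w z.1 z.2‖ₑ ^ 2 * ‖mollifiedDrift η ε w z.1 z.2‖ₑ ≤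
        C * (∫⁻ s in Ioo (0 : ℝ) t, (supBallEnergy w s ^ 3 + supBallEnergy w s)) +
          γ * ∫⁻ z in Ioo (0 : ℝ) t ×ˢ (univ : Set (EuclideanSpace ℝ (Fin 3))),
            ENNReal.ofReal (χ z.2 ^ 2 * frobeniusNormSq (H z.1 z.2)) := by
  set L : ℝ≥0∞ := ENNReal.ofReal (c ^ 2) + ENNReal.ofReal (c ^ 4) with hL
  have hL0 : L ≠ 0 :=
    (lt_of_lt_of_le (ENNReal.ofReal_pos.2 (by positivity : (0 : ℝ) < c ^ 2)) le_self_add).ne'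
  have hLt : L ≠ ⊤ := ENNReal.add_ne_top.2 ⟨ENNReal.ofReal_ne_top, ENNReal.ofReal_ne_top⟩
  have hγ'0 : γ / L ≠ 0 := by
    rw [Ne, ENNReal.div_eq_zero_iff]; push Not; exact ⟨hγ0, hLt⟩
  have hγ't : γ / L ≠ ⊤ := ENNReal.div_ne_top hγt hL0
  obtain ⟨C, hCt, hGN⟩ := setLIntegral_unitCylinder_cube_le hc hw hws hH hHm hχ hχ1 hM hχc hχB
    hγ'0 hγ't
  refine ⟨L * C, ENNReal.mul_ne_top hLt hCt, fun t ht0 ht1 => ?_⟩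
  calc ∫⁻ z in Ioo (0 : ℝ) t ×ˢ ball (0 : EuclideanSpace ℝ (Fin 3)) c,
          ‖w z.1 z.2‖ₑ ^ 2 * ‖mollifiedDrift η ε w z.1 z.2‖ₑ
      ≤ L * ∫⁻ z in Ioo (0 : ℝ) t ×ˢ ball (0 : EuclideanSpace ℝ (Fin 3)) 1, ‖w z.1 z.2‖ₑ ^ (3 : ℝ) :=
        setLIntegral_cylinder_sq_mul_drift_le hc hηc hη0 hη1 hηρ hε hερ finrank_euclideanSpace_fin
          hw hwm ht0 ht1
    _ ≤ L * (C * (∫⁻ s in Ioo (0 : ℝ) t, (supBallEnergy w s ^ 3 + supBallEnergy w s)) +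
          γ / L * ∫⁻ z in Ioo (0 : ℝ) t ×ˢ (univ : Set (EuclideanSpace ℝ (Fin 3))),
            ENNReal.ofReal (χ z.2 ^ 2 * frobeniusNormSq (H z.1 z.2))) :=
        mul_le_mul' le_rfl (hGN t ht0)
    _ = L * C * (∫⁻ s in Ioo (0 : ℝ) t, (supBallEnergy w s ^ 3 + supBallEnergy w s)) +
          γ * ∫⁻ z in Ioo (0 : ℝ) t ×ˢ (univ : Set (EuclideanSpace ℝ (Fin 3))),
            ENNReal.ofReal (χ z.2 ^ 2 * frobeniusNormSq (H z.1 z.2)) := by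
        rw [mul_add, ← mul_assoc, ← mul_assoc, ENNReal.mul_div_cancel hL0 hLt]

end R3

end BradshawTsai2019

end Literature.Analysis.FluidPDE

end
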